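import Summits.SmoothPoincare4.SmoothPoincare4.Theses.EntropyRung
import Summits.SmoothPoincare4.SmoothPoincare4.Theorems.EntropyRungSubcylindricalExistenceSphereSideClauseAux
import Mathlib.Analysis.SpecialFunctions.Log.Basic
import Mathlib.Analysis.InnerProductSpace.Basic
import HarnessLib

/-!
# Algebraic helpers for stub `stub_capClauseEuclideanSchwarzschild` (E2, line
# `green-blowup-conformal-entropy`, reshape R-c3, crux `EntropyRung.SubcylindricalExistence`,
# item stmt-SmoothPoincare4-10871)

The pointwise (real-algebra) part of the perturbative cap clause in the Schwarzschild gauge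
(main file `…CapClauseEuclideanSchwarzschild.lean`): the numerics of the constants
(`p = bρ₁²/a ≤ θ`, `q = b/(4K) ≤ θ/4`, `θ ≤ 1/100`: the potential coefficient `M ≤ 6θ`, both
brackets `≥ κ = 1 − 20θ`, `2 log κ ≥ −100θ`); the factorisation `Ψ = u ψ₀` of the cap factor and the
curvature constants; the cross-term estimate and the pointwise **gradient estimate**
`Ψ²‖∇v‖² ≥ (1−t)u_max⁻²ψ₀²‖∇w‖² − (1/t−1)·16μ²β²(ρ₁²+E)²·C²m/(m+E)⁴·w²` for `w = u²v`
(registered helper `helper_capClauseEuclideanSchwarzschildGrad`); the entropy estimate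
`v² log v² Ψ⁴ ≤ ψ₀⁴ w² log w²`; and the assembly of the pointwise comparison. [folklore]
-/

noncomputable section

-- the registered namespace `Summit.SmoothPoincare4.SmoothPoincare4.Theorems` repeats a component
set_option linter.dupNamespace false

open scoped Manifold ContDiff Topology RealInnerProductSpace
open Set Filter MeasureTheory

namespace Summit.SmoothPoincare4.SmoothPoincare4.Theorems

namespace CapClauseEuclideanSchwarzschildAlg

open SphereSideClause

/-- Numerics: with `p = bρ₁²/a ≤ θ`, `q = b/(4K) ≤ θ/4`, `θ ≤ 1/100`, the potential coefficient
`M = 16(1/(5θ) − 1)(p + q + pq)²` satisfies `0 ≤ M ≤ 6θ`. [folklore] -/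
theorem numerics_M {p q θ : ℝ} (hp : 0 ≤ p) (hpθ : p ≤ θ) (hq : 0 ≤ q) (hqθ : q ≤ θ / 4)
    (hθ : 0 < θ) (hθ1 : θ ≤ 1 / 100) :
    0 ≤ 16 * (1 / (5 * θ) - 1) * (p + q + p * q) ^ 2 ∧
      16 * (1 / (5 * θ) - 1) * (p + q + p * q) ^ 2 ≤ 6 * θ := by
  have hs0 : 0 ≤ p + q + p * q := by positivity
  have hs : p + q + p * q ≤ (1253 / 1000) * θ := by
    nlinarith [mul_le_mul hpθ hqθ hq (hp.trans hpθ)]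
  have ht : 0 ≤ 1 / (5 * θ) - 1 := by
    rw [sub_nonneg, le_div_iff₀ (by positivity)]
    linarith
  refine ⟨by positivity, ?_⟩
  have hs2 : (p + q + p * q) ^ 2 ≤ ((1253 / 1000) * θ) ^ 2 := pow_le_pow_left₀ hs0 hs 2
  calc 16 * (1 / (5 * θ) - 1) * (p + q + p * q) ^ 2
      ≤ 16 * (1 / (5 * θ)) * ((1253 / 1000) * θ) ^ 2 := by
        apply mul_le_mul (by nlinarith) hs2 (sq_nonneg _) (by positivity)
    _ = (16 * (1253 / 1000) ^ 2 / 5) * θ := by field_simp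
    _ ≤ 6 * θ := by nlinarith

/-- Numerics: the curvature bracket `u_max⁻³ − M/3` and the Dirichlet bracket
`(1−5θ)u_max⁻² − M` are `≥ κ = 1 − 20θ`, `u_max = (1+q)(1+p)`. [folklore] -/
theorem numerics_brackets {p q θ M : ℝ} (hp : 0 ≤ p) (hpθ : p ≤ θ) (hq : 0 ≤ q) (hqθ : q ≤ θ / 4)
    (hθ1 : θ ≤ 1 / 100) (hM : M ≤ 6 * θ) :
    1 - 20 * θ ≤ (((1 + q) * (1 + p)) ^ 3)⁻¹ - M / 3 ∧
      1 - 20 * θ ≤ (1 - 5 * θ) * (((1 + q) * (1 + p)) ^ 2)⁻¹ - M := by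
  set X := (1 + q) * (1 + p) with hX
  have hX1 : 1 ≤ X := by rw [hX]; nlinarith
  have hXle : X ≤ 1 + (1253 / 1000) * θ := by
    rw [hX]; nlinarith [mul_le_mul hqθ hpθ hp (hq.trans hqθ)]
  have hX0 : 0 < X := by linarith
  have h3 : 1 - 3 * (X - 1) ≤ (X ^ 3)⁻¹ := by
    rw [← sub_nonneg]
    have e : (X ^ 3)⁻¹ - (1 - 3 * (X - 1)) = (X - 1) ^ 2 * (3 * X ^ 2 + 2 * X + 1) / X ^ 3 := by
      field_simp
      ring
    rw [e]
    positivity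
  have h2 : 1 - 2 * (X - 1) ≤ (X ^ 2)⁻¹ := by
    rw [← sub_nonneg]
    have e : (X ^ 2)⁻¹ - (1 - 2 * (X - 1)) = (X - 1) ^ 2 * (2 * X + 1) / X ^ 2 := by
      field_simp
      ring
    rw [e]
    positivity
  constructor
  · linarith
  · have h5 : 0 ≤ 1 - 5 * θ := by linarith
    have h6 : (1 - 5 * θ) * (1 - 2 * (X - 1)) ≤ (1 - 5 * θ) * (X ^ 2)⁻¹ :=
      mul_le_mul_of_nonneg_left h2 h5
    nlinarith

/-- Numerics: `2 log(1 − 20θ) ≥ −100θ` for `0 < θ ≤ 1/100`. [folklore] -/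
theorem numerics_log {θ : ℝ} (hθ : 0 < θ) (hθ1 : θ ≤ 1 / 100) :
    -(100 * θ) ≤ 2 * Real.log (1 - 20 * θ) := by
  have hκ : 0 < 1 - 20 * θ := by linarith
  have h := Real.one_sub_inv_le_log_of_pos hκ
  have e : 1 - (1 - 20 * θ)⁻¹ = -(20 * θ) / (1 - 20 * θ) := by
    field_simp
    ring
  rw [e] at h
  have h2 : -(50 * θ) ≤ -(20 * θ) / (1 - 20 * θ) := by
    rw [le_div_iff₀ hκ]
    nlinarith
  linarith

/-- The factorisation of the cap factor `Ψ = u · ψ₀`: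
`4K(a+bm)/((4K+b)m+a) = μ(1+βm) · C/(m+E)` with `μ = (4K+b)/(4K)`, `β = b/a`, `C = a/μ²`,
`E = a/(4K+b)`. [folklore] -/
theorem factorisation {K a b m : ℝ} (hK : 0 < K) (ha : 0 < a) (hb : 0 ≤ b) (hm : 0 ≤ m) :
    4 * K * (a + b * m) / ((4 * K + b) * m + a) =
      ((4 * K + b) / (4 * K) * (1 + b / a * m)) *
        (a / ((4 * K + b) / (4 * K)) ^ 2 / (m + a / (4 * K + b))) := by
  have h1 : 0 < (4 * K + b) * m + a := by positivity
  have h2 : 0 < 4 * K + b := by positivity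
  field_simp

/-- The curvature constants: `u_max⁻³ · 48E/C² = 12a²/(K(a+bρ₁²)³)`. [folklore] -/
theorem curv_identity {K a b ρ2 : ℝ} (hK : 0 < K) (ha : 0 < a) (hb : 0 ≤ b) (hρ : 0 ≤ ρ2) :
    (((4 * K + b) / (4 * K) * (1 + b / a * ρ2)) ^ 3)⁻¹ *
        (48 * (a / (4 * K + b)) / (a / ((4 * K + b) / (4 * K)) ^ 2) ^ 2) =
      12 * a ^ 2 / (K * (a + b * ρ2) ^ 3) := by
  have h2 : 0 < 4 * K + b := by positivity
  have h3 : 0 < a + b * ρ2 := by positivity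
  field_simp
  ring

/-- The curvature weight `12a²/(K(a+bm)³)` is monotone decreasing in `m`. [folklore] -/
theorem curv_compare {K a b m ρ2 : ℝ} (hK : 0 < K) (ha : 0 < a) (hb : 0 ≤ b) (hm : 0 ≤ m)
    (hmρ : m ≤ ρ2) :
    12 * a ^ 2 / (K * (a + b * ρ2) ^ 3) ≤ 12 * a ^ 2 / (K * (a + b * m) ^ 3) := by
  have h3 : 0 < a + b * m := by positivity
  apply div_le_div_of_nonneg_left (by positivity) (by positivity)
  exact mul_le_mul_of_nonneg_left (pow_le_pow_left₀ h3.le (by nlinarith) 3) hK.le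

/-- `(4π κτ)^{-2} = (4πτ)^{-2}/κ²`. [folklore] -/
theorem rpow_scale {κ τ : ℝ} (hκ : 0 < κ) (hτ : 0 < τ) :
    (4 * Real.pi * (κ * τ)) ^ (-(4 : ℝ) / 2) = (4 * Real.pi * τ) ^ (-(4 : ℝ) / 2) / κ ^ 2 := by
  have hpi := Real.pi_pos
  rw [rpow_neg_four_half (by positivity), rpow_neg_four_half (by positivity)]
  field_simp

/-- The cross-term estimate `‖A − k z‖² ≥ (1−t)‖A‖² − (1/t − 1) k²‖z‖²` (`2⟨A,B⟩ ≤ t‖A‖² + ‖B‖²/t`).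
[folklore] -/
theorem cross_estimate {F : Type*} [NormedAddCommGroup F] [InnerProductSpace ℝ F] (A z : F)
    (k : ℝ) {t : ℝ} (ht : 0 < t) :
    (1 - t) * ‖A‖ ^ 2 - (1 / t - 1) * (k ^ 2 * ‖z‖ ^ 2) ≤ ‖A - k • z‖ ^ 2 := by
  rw [norm_sub_sq_real, real_inner_smul_right, norm_smul, mul_pow, Real.norm_eq_abs, sq_abs]
  have hI : |⟪A, z⟫| ≤ ‖A‖ * ‖z‖ := abs_real_inner_le_norm A z
  have hk : k * ⟪A, z⟫ ≤ |k| * (‖A‖ * ‖z‖) := by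
    calc k * ⟪A, z⟫ ≤ |k * ⟪A, z⟫| := le_abs_self _
      _ = |k| * |⟪A, z⟫| := abs_mul _ _
      _ ≤ |k| * (‖A‖ * ‖z‖) := mul_le_mul_of_nonneg_left hI (abs_nonneg _)
  have hsq : 0 ≤ (t * ‖A‖ - |k| * ‖z‖) ^ 2 := sq_nonneg _
  have hkk : |k| ^ 2 = k ^ 2 := sq_abs k
  have key : 0 ≤ t ^ 2 * ‖A‖ ^ 2 - 2 * t * (k * ⟪A, z⟫) + k ^ 2 * ‖z‖ ^ 2 := by nlinarith
  have e : ‖A‖ ^ 2 - 2 * (k * ⟪A, z⟫) + k ^ 2 * ‖z‖ ^ 2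
      - ((1 - t) * ‖A‖ ^ 2 - (1 / t - 1) * (k ^ 2 * ‖z‖ ^ 2))
      = (t ^ 2 * ‖A‖ ^ 2 - 2 * t * (k * ⟪A, z⟫) + k ^ 2 * ‖z‖ ^ 2) / t := by
    field_simp
    ring
  rw [← sub_nonneg, e]
  positivity

/-- **The gradient term, pointwise.** With `Ψ = u ψ₀`, `w = u² v`, `∇w = u²∇v + k z`
(`k = 2uv·2μβ`), `1 ≤ u ≤ u_max`, `‖z‖² ≤ ρ₁²`:
`Ψ²‖∇v‖² ≥ (1−t) u_max⁻² ψ₀²‖∇w‖² − (1/t−1)·16μ²β²(ρ₁²+E)² · C²‖z‖²/(‖z‖²+E)⁴ · w²`. [folklore] -/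
theorem grad_estimate {F : Type*} [NormedAddCommGroup F] [InnerProductSpace ℝ F] (gv gw z : F)
    {U umax C E ρ2 V μ β t : ℝ} (hU1 : 1 ≤ U) (hUmax : U ≤ umax) (hE : 0 < E)
    (hmρ : ‖z‖ ^ 2 ≤ ρ2) (ht : 0 < t) (ht1 : t ≤ 1)
    (hgw : gw = U ^ 2 • gv + (2 * U * V * (2 * μ * β)) • z) :
    (1 - t) * (umax ^ 2)⁻¹ * ((C / (‖z‖ ^ 2 + E)) ^ 2 * ‖gw‖ ^ 2)
      - (1 / t - 1) * (16 * μ ^ 2 * β ^ 2 * (ρ2 + E) ^ 2)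
        * (C ^ 2 * ‖z‖ ^ 2 / (‖z‖ ^ 2 + E) ^ 4 * (U ^ 2 * V) ^ 2)
      ≤ (U * (C / (‖z‖ ^ 2 + E))) ^ 2 * ‖gv‖ ^ 2 := by
  set m := ‖z‖ ^ 2 with hm
  set P := C / (m + E) with hP
  set k := 2 * U * V * (2 * μ * β) with hk
  have hU0 : 0 < U := by linarith
  have hmE : 0 < m + E := by positivity
  have hsub : U ^ 2 • gv = gw - k • z := by rw [hgw]; abel
  have hnorm : U ^ 4 * ‖gv‖ ^ 2 = ‖gw - k • z‖ ^ 2 := by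
    rw [← hsub, norm_smul, mul_pow, Real.norm_eq_abs, sq_abs]; ring
  have hcross := cross_estimate gw z k ht
  rw [← hm] at hcross
  have h1 : (U * P) ^ 2 * ‖gv‖ ^ 2 = P ^ 2 * (U ^ 2)⁻¹ * ‖gw - k • z‖ ^ 2 := by
    rw [← hnorm]; field_simp
  have h2 : P ^ 2 * (U ^ 2)⁻¹ * ((1 - t) * ‖gw‖ ^ 2 - (1 / t - 1) * (k ^ 2 * m)) ≤
      P ^ 2 * (U ^ 2)⁻¹ * ‖gw - k • z‖ ^ 2 :=
    mul_le_mul_of_nonneg_left hcross (by positivity)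
  have h3 : (umax ^ 2)⁻¹ ≤ (U ^ 2)⁻¹ :=
    inv_anti₀ (by positivity) (pow_le_pow_left₀ hU0.le hUmax 2)
  have h4 : (1 - t) * (umax ^ 2)⁻¹ * (P ^ 2 * ‖gw‖ ^ 2) ≤
      (1 - t) * (U ^ 2)⁻¹ * (P ^ 2 * ‖gw‖ ^ 2) :=
    mul_le_mul_of_nonneg_right (mul_le_mul_of_nonneg_left h3 (by linarith)) (by positivity)
  have h5 : P ^ 2 * (U ^ 2)⁻¹ * (k ^ 2 * m) =
      16 * μ ^ 2 * β ^ 2 * ((m + E) ^ 2 * (C ^ 2 * m / (m + E) ^ 4 * V ^ 2)) := by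
    rw [hk, hP]; field_simp; ring
  have hV2 : V ^ 2 ≤ (U ^ 2 * V) ^ 2 := by
    rw [mul_pow]
    have : 1 ≤ (U ^ 2) ^ 2 := one_le_pow₀ (one_le_pow₀ hU1)
    nlinarith [sq_nonneg V]
  have h6 : (m + E) ^ 2 * (C ^ 2 * m / (m + E) ^ 4 * V ^ 2) ≤
      (ρ2 + E) ^ 2 * (C ^ 2 * m / (m + E) ^ 4 * (U ^ 2 * V) ^ 2) := by
    apply mul_le_mul (pow_le_pow_left₀ hmE.le (by linarith) 2) _ (by positivity) (by positivity)
    exact mul_le_mul_of_nonneg_left hV2 (by positivity)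
  have h7 : 0 ≤ (1 / t - 1) := by
    rw [sub_nonneg, le_div_iff₀ ht]; linarith
  have h8 : (1 / t - 1) * (16 * μ ^ 2 * β ^ 2 * ((m + E) ^ 2 * (C ^ 2 * m / (m + E) ^ 4 * V ^ 2)))
      ≤ (1 / t - 1) * (16 * μ ^ 2 * β ^ 2 * (ρ2 + E) ^ 2)
        * (C ^ 2 * m / (m + E) ^ 4 * (U ^ 2 * V) ^ 2) := by
    rw [mul_assoc (1 / t - 1) (16 * μ ^ 2 * β ^ 2 * (ρ2 + E) ^ 2)]
    refine mul_le_mul_of_nonneg_left ?_ h7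
    rw [mul_assoc (16 * μ ^ 2 * β ^ 2)]
    exact mul_le_mul_of_nonneg_left h6 (by positivity)
  rw [h1]
  have e : P ^ 2 * (U ^ 2)⁻¹ * ((1 - t) * ‖gw‖ ^ 2 - (1 / t - 1) * (k ^ 2 * m)) =
      (1 - t) * (U ^ 2)⁻¹ * (P ^ 2 * ‖gw‖ ^ 2)
        - (1 / t - 1) * (P ^ 2 * (U ^ 2)⁻¹ * (k ^ 2 * m)) := by
    ring
  rw [e, h5] at h2
  linarith

/-- **The entropy term, pointwise.** `v² log(v²) Ψ⁴ ≤ ψ₀⁴ w² log(w²)` for `w = u²v`,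
`Ψ = uψ₀`, `u ≥ 1` (`log w² = log v² + log u⁴ ≥ log v²`). [folklore] -/
theorem log_estimate (V U P : ℝ) (hU : 1 ≤ U) :
    V ^ 2 * Real.log (V ^ 2) * (U * P) ^ 4 ≤
      P ^ 4 * (U ^ 2 * V) ^ 2 * Real.log ((U ^ 2 * V) ^ 2) := by
  by_cases hV : V = 0
  · simp [hV]
  · have hU0 : 0 < U := by linarith
    have hV2 : V ^ 2 ≠ 0 := pow_ne_zero 2 hV
    have hU4 : (U ^ 2) ^ 2 ≠ 0 := by positivity
    rw [show (U ^ 2 * V) ^ 2 = (U ^ 2) ^ 2 * V ^ 2 by ring, Real.log_mul hU4 hV2]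
    have hlogU : 0 ≤ Real.log ((U ^ 2) ^ 2) := Real.log_nonneg (one_le_pow₀ (one_le_pow₀ hU))
    have h0 : 0 ≤ P ^ 4 * ((U ^ 2) ^ 2 * V ^ 2) * Real.log ((U ^ 2) ^ 2) := by positivity
    nlinarith [h0]

/-- Assembly of the pointwise estimates (curvature, gradient, entropy, normalisation) into the
comparison of the cap integrand with the round integrand of `w`. [folklore] -/
theorem combine {R V Q P W G2 Gv X X3 LV LW τ c k0 t umax M e4 : ℝ} (hτ : 0 ≤ τ) (hc : 0 ≤ c)
    (hcurv : k0 * (P ^ 4 * W ^ 2) ≤ R * V ^ 2 * Q ^ 4)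
    (hgrad : (1 - t) * (umax ^ 2)⁻¹ * G2 - M * X ≤ Q⁻¹ ^ 2 * Gv * Q ^ 4)
    (hlog : V ^ 2 * LV * Q ^ 4 ≤ P ^ 4 * W ^ 2 * LW) (hnorm : V ^ 2 * Q ^ 4 = P ^ 4 * W ^ 2)
    (hX : X = X3 + e4 * (P ^ 4 * W ^ 2)) :
    (τ * c * k0 - 4 * τ * c * M * e4 - 4 * c) * (P ^ 4 * W ^ 2)
        + 4 * τ * c * (1 - t) * (umax ^ 2)⁻¹ * G2 + -(4 * τ * c * M) * X3
        - c * (P ^ 4 * (W ^ 2 * LW))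
      ≤ (τ * (R * V ^ 2 + 4 * (Q⁻¹ ^ 2 * Gv)) - V ^ 2 * LV - 4 * V ^ 2) * (c * Q ^ 4) := by
  have h1 : τ * c * (k0 * (P ^ 4 * W ^ 2)) ≤ τ * c * (R * V ^ 2 * Q ^ 4) :=
    mul_le_mul_of_nonneg_left hcurv (by positivity)
  have h2 : 4 * τ * c * ((1 - t) * (umax ^ 2)⁻¹ * G2 - M * X) ≤
      4 * τ * c * (Q⁻¹ ^ 2 * Gv * Q ^ 4) :=
    mul_le_mul_of_nonneg_left hgrad (by positivity)
  have h3 : c * (V ^ 2 * LV * Q ^ 4) ≤ c * (P ^ 4 * W ^ 2 * LW) :=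
    mul_le_mul_of_nonneg_left hlog hc
  have e : (τ * (R * V ^ 2 + 4 * (Q⁻¹ ^ 2 * Gv)) - V ^ 2 * LV - 4 * V ^ 2) * (c * Q ^ 4) =
      τ * c * (R * V ^ 2 * Q ^ 4) + 4 * τ * c * (Q⁻¹ ^ 2 * Gv * Q ^ 4) - c * (V ^ 2 * LV * Q ^ 4)
        - 4 * c * (V ^ 2 * Q ^ 4) := by ring
  rw [e, hnorm]
  rw [hX] at h2
  nlinarith [h1, h2, h3]

end CapClauseEuclideanSchwarzschildAlg

/-- **Registered helper `helper_capClauseEuclideanSchwarzschildGrad` of stub E2** (line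
`green-blowup-conformal-entropy`, crux stmt-SmoothPoincare4-10871): the pointwise gradient estimate
of the substitution `w = u²v` (`CapClauseEuclideanSchwarzschildAlg.grad_estimate`). [folklore] -/
theorem helper_capClauseEuclideanSchwarzschildGrad :
    ∀ (gv gw z : EuclideanSpace ℝ (Fin 4)) (U umax C E ρ2 V μ β t : ℝ), 1 ≤ U → U ≤ umax → 0 < E →
      ‖z‖ ^ 2 ≤ ρ2 → 0 < t → t ≤ 1 → gw = U ^ 2 • gv + (2 * U * V * (2 * μ * β)) • z →
      (1 - t) * (umax ^ 2)⁻¹ * ((C / (‖z‖ ^ 2 + E)) ^ 2 * ‖gw‖ ^ 2)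
        - (1 / t - 1) * (16 * μ ^ 2 * β ^ 2 * (ρ2 + E) ^ 2)
          * (C ^ 2 * ‖z‖ ^ 2 / (‖z‖ ^ 2 + E) ^ 4 * (U ^ 2 * V) ^ 2)
        ≤ (U * (C / (‖z‖ ^ 2 + E))) ^ 2 * ‖gv‖ ^ 2 :=
  fun gv gw z _ _ _ _ _ _ _ _ _ hU1 hUmax hE hm ht ht1 hgw ↦
    CapClauseEuclideanSchwarzschildAlg.grad_estimate gv gw z hU1 hUmax hE hm ht ht1 hgw

end Summit.SmoothPoincare4.SmoothPoincare4.Theorems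

end
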